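import Summits.QuantumFields.YangMills.Theorems.UnitScaleTiltProp7Lane2ChartInGrid
import Summits.QuantumFields.YangMills.Theorems.UnitScaleTiltProp7BoxLocalResidualCurlReading
import Summits.QuantumFields.YangMills.Theorems.UnitScaleTiltProp7TiledCubeMemberH7H8PeeledIndex
import Summits.QuantumFields.YangMills.Theorems.UnitScaleTiltProp7TiledCubeMemberH7H8
import Summits.QuantumFields.YangMills.Theorems.UnitScaleTiltProp7SPrintDefs
import HarnessLib

/-!
# Route `UnitScaleTilt`, crux K1 «MinimiserStabilityRegPr» (stmt-QuantumFields-19200) — LANE II «DIVERGENCE RECOVERY AT CURVED `W`» (★★OWNER RULING №23),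
# (B7) member knit [I-9] «(FEEDS)»: **THE FEED ROWS OF THE PATCHES1 WRAPPER** — the chart-side resource letters of one patch (`N_T`, the (h4) curl functional, the local curl
# letter `CuW`, the peeled coarse sum, the transition-cube mass) dominated by px9's grid-patch sums at `D = 2·L^s + 2` ∕ the peeled box mass, in the letters of
# ⧗`patch_rows_core` (w1 g16) and of the closed per-patch schema `hP1` (✓p724687 px12 g9)

Cell `ym3-torus` ∕ width seat `ym3-torus-px4` (gen 9; ★p1 g20 2026-08-29 14:20Z «GO — … YOURS, INCLUDING `feedBoxS`»).  THEOREMS ONLY (0 `def`, 0 `sorry`);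
`--supports stmt-QuantumFields-19200 --as helper`, count-neutral.  YM₃ on T³ is a ladder rung (R3), NOT d = 4, NOT infinite volume, NOT a mass gap, NOT the Clay problem; nothing
here claims (B7), (REC), `hN06`, E′, EX or the gap.

WHY.  `patch_rows_core` (w1-19200 g16) proves every per-patch row of one member patch from the bricks, taking as DATA: a bond set `T ∋` the inside-chart bonds, a curl currency
`Cu` with `hCurl : (h4)'s chart curl functional ≤ Cc·ℓ⁻²·Cu`, and the transition-cube mass bound `hboxS`; and it returns h9∕h10 in the LOCAL curl letter `CuW` (curl of `y` summed
over the chart box).  The closed schema `hP1` that PATCHES2 consumes wants instead THREE FEEDS over px9's grid patches at the corner centre `c = corner g`: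
`N ≤ Σ_(bond patch) c₀‖y b‖_F²`, `Cu ≤ Σ_(site patch) c₀ℓ²·CURL_HS-summand`, `As ≤ Σ_(coarse patch) …`.  This file is the bridge, all by name over landed rows:
✓`Prop7Lane2ChartInGrid.transl_mem_gridPatch_sites∕_bonds` (chart point ⟹ grid patch), ✓`Prop7BoxLocalResidualCurlReading.box_curlF_le_two_mul_curlHS_on` (w4: chart curl
functional ≤ 2·CURL_HS over any site set containing the chart), ✓`Prop7TiledCubeMemberH7H8.sum_le_boxSum_of_chart` + ✓`Prop7TiledCubeMemberH7H8PeeledIndex.exists_mem_peeledBox_of_dist_lt`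
(px9: a cube inside the chart is paid by the peeled box, `p = 5`).

WHAT IS PROVED (ns `…Theorems.Prop7DivRecoveryPatchFeeds`; chart data EXACTLY as `patch_rows_core`: corner centre `c`, `(z, R) = (z_c, R_f)` by the equations `hz hRdef`,
`hRN : 2R + 1 ≤ N₀`; grid index `g` with `hcg : iterBlockOf (K−n) c = (κ ↦ ↑(g_κ·L^s))`):
* ★ `feedN` — `c₀·Σ_(b ∈ T)‖frobEquiv⁻¹(toL2⁻¹ y b)‖² ≤ Σ_(b ∈ T) c₀·‖…‖²` (any `T`; `Finset.mul_sum`) — hP1's `N`-feed at `T :=` the bond patch, named so the wrapper `exact`s it.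
* ★ `hT_bondPatch` — the `hT` hypothesis of `patch_rows_core` ∕ ✓`patch_hN` at `T :=` px9's bond patch (`D = 2L^s + 2`): every inside-chart bond is in it.
* ★★ `feedCu` — `patch_rows_core`'s `hCurl` HYPOTHESIS DISCHARGED at `Cc := 2`, `Cu := Σ_(x ∈ site patch) c₀·ℓ²·Σ_(μ<ν)‖curl_W y (x)‖_F²` (hP1's Cu-feed right side token for token,
  so the `Cu`-feed conjunct of hP1 is `le_rfl`).
* ★★ `feedCuW` — the LOCAL curl letter `c₀·ℓ²·Σ_(w ∈ box z R) Σ_(μ<ν)‖curl_W y (transl basePt w)‖_F² ≤ Cu` (same `Cu`; `Finset.sum_image` over the injective chart + patch membership).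
* ★ `feedAs` — `Σ_(ĉ ∈ S) w ĉ ≤ Σ_(ĉ ∈ coarse patch) w ĉ` for every `w ≥ 0` and every coarse-bond set `S` with the peel margin `dist(ĉ.src κ, C κ) + 3 ≤ 2L^s` (w1's `hSC`),
  `C κ = ↑(g_κ·L^s)`.
* ★★ `feedBoxS` — `patch_rows_core`'s `hboxS` HYPOTHESIS DISCHARGED, universal in the field: `c₀·Σ_(x ∈ Scube(c, L^s·ℓ+2)) hs(toL2S⁻¹ φ′ x) ≤ c₀·Σ_(w ∈ box z Rin) hs(toL2S⁻¹ φ′ (transl basePt w))`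
  with `Rin + 5·ℓ = R` (PEEL `p = 5`, needs `5 ≤ L^s`) — the peeled box mass of ✓`h7h8_member_peeled`∕✓`currency_h7h8_peeled`.
HONEST SCOPE.  `Finset` plumbing over landed rows; nothing of the lattice gauge theory, of print, of (B7)∕(REC)∕`hN06`∕the crux is asserted; rung R3, not Clay; YM gap NOT proved.

References: T. Bałaban, CMP 99 (1985) 389–434 [Balaban1985BackgroundPropagators] ((3.10) p.392, (3.100) p.413: localisation at scale `M`, finite overlap of the cubes);
[folklore] (`Finset.sum_image`, double counting).
-/

set_option autoImplicit false

noncomputable section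

open scoped BigOperators Matrix.Norms.L2Operator Matrix

namespace Summit.QuantumFields.YangMills.Theorems.Prop7DivRecoveryPatchFeeds

open Literature.MathematicalPhysics.QuantumFieldTheory.Balaban1983to89
open Literature.MathematicalPhysics.QuantumFieldTheory.Balaban1983to89.T3ContinuumYM3Torus
open Literature.MathematicalPhysics.QuantumFieldTheory.Balaban1983to89.B4Eq19LatticeOperators (Zd box mem_box unitVec)
open B5Eq118OneStroke (iterBlockOf)
open B10Eq27TorusAxialLog (transl unitsField toUField)
open B9TorusCalculus (torusT)
open B9Eq39Adjoint (curl)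
open B7Eq78Linearization (conjR)
open B11Eq103H1Complex (SiteL2K BondL2K)
open Summit.QuantumFields.YangMills.Theorems.Prop7SectET3Transport (periodsT3)
open Summit.QuantumFields.YangMills.Theorems.Prop7SectET3HilbertLetters (W₂ frobEquiv toL2 toL2S)
open Summit.QuantumFields.YangMills.Theorems.Prop7SPrint (basePt)
open Summit.QuantumFields.YangMills.Theorems.Prop7BoxChartTransport (transl_injOn_box)
open Summit.QuantumFields.YangMills.Theorems.Prop7BoxLocalResidualCurlReading (box_curlF_le_two_mul_curlHS_on)
open Summit.QuantumFields.YangMills.Theorems.Prop7TiledCubeMemberH7H8 (sum_le_boxSum_of_chart)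
open Summit.QuantumFields.YangMills.Theorems.Prop7TiledCubeMemberH7H8PeeledIndex (exists_mem_peeledBox_of_dist_lt)
open Summit.QuantumFields.YangMills.Theorems.Prop7Lane2ChartInGrid (transl_mem_gridPatch_sites transl_mem_gridPatch_bonds)

variable (F : T3Family) (n K s : ℕ) (c₀ : ℝ) [hc₀ : Fact (0 < c₀)]

/-! ## §1 The `N`-feed and the bond-patch membership -/

omit hc₀ in
/-- ★ **THE `N`-FEED, NAMED**: `c₀·Σ_(b∈T)‖frobEquiv⁻¹(toL2⁻¹ y b)‖² ≤ Σ_(b∈T) c₀·‖frobEquiv⁻¹(toL2⁻¹ y b)‖²` (equality by `Finset.mul_sum`) — hP1's `N`-feed at `T :=` the bond patch, with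
`N := N_T` the left side. [folklore] -/
theorem feedN (y : BondL2K ℂ 3 (periodsT3 F K) c₀ W₂) (T : Finset (PBond (F.P K) 0)) :
    c₀ * ∑ b ∈ T, ‖(frobEquiv.symm ((toL2 F K c₀).symm y b) : W₂)‖ ^ 2 ≤ ∑ b ∈ T, c₀ * ‖(frobEquiv.symm ((toL2 F K c₀).symm y b) : W₂)‖ ^ 2 := by
  rw [Finset.mul_sum]

omit hc₀ in
/-- ★ **`hT` AT THE BOND PATCH**: with the centre's block equal to the grid site `κ ↦ ↑(g_κ·L^s)`, every bond `⟨transl basePt w, μ⟩` with `w` in the record box `(z_c, R_f)` lies in px9's bond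
patch at `D = 2·L^s + 2` — the `hT` hypothesis of ⧗`patch_rows_core` ∕ ✓`Prop7DivRecoveryCutoffReadings.patch_hN` (the extra premise `w + e_μ ∈ box` is not needed).
[cite: Balaban1985BackgroundPropagators, (3.100) p.413] -/
theorem hT_bondPatch (hnK : n ≤ K) (c : Site (F.P K) 0) (g : Fin 3 → ℕ)
    (hcg : iterBlockOf (K - n) c = fun κ => ((g κ * F.L ^ s : ℕ) : ZMod ((F.P K).sitesPerDir (K - n))))
    (z : Zd (F.P K).d) (R : ℤ)
    (hz : z = (fun κ : Fin (F.P K).d => ((F.L ^ (K - n) : ℕ) : ℤ) *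
          (((((c κ).val : ℕ) : ℤ) - ((((basePt F n K) κ).val : ℕ) : ℤ)) / ((F.L ^ (K - n) : ℕ) : ℤ)) + (((F.L ^ (K - n) : ℕ) : ℤ) - 1) / 2))
    (hRdef : R = ((2 * ((F.L ^ s : ℕ) : ℤ) + 1) * ((F.L ^ (K - n) : ℕ) : ℤ) + (((F.L ^ (K - n) : ℕ) : ℤ) - 1) / 2)) :
    ∀ w ∈ box z R, ∀ μ : Fin (F.P K).d, w + unitVec μ ∈ box z R →
      (⟨transl (basePt F n K) w, μ⟩ : PBond (F.P K) 0) ∈ Finset.univ.filter (fun b : PBond (F.P K) 0 => ∀ κ : Fin 3,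
          min ((iterBlockOf (K - n) b.src) κ - ((g κ * F.L ^ s : ℕ) : ZMod ((F.P K).sitesPerDir (K - n)))).val
            ((((g κ * F.L ^ s : ℕ) : ZMod ((F.P K).sitesPerDir (K - n)))) - (iterBlockOf (K - n) b.src) κ).val ≤ 2 * F.L ^ s + 2) := by
  subst hz hRdef
  intro w hw μ _
  exact transl_mem_gridPatch_bonds F n K s hnK (basePt F n K) c g hcg w hw μ

/-! ## §2 The curl feeds -/

/-- ★★ **THE CURL CURRENCY OF THE PATCH — `patch_rows_core`'s `hCurl` DISCHARGED at `Cc := 2`, `Cu := Σ_(x ∈ site patch) c₀·ℓ²·Σ_(μ<ν)‖curl_W y x‖_F²`** (hP1's Cu-feed right side).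
Proof: w4's ✓`box_curlF_le_two_mul_curlHS_on` over the site patch (membership ✓`transl_mem_gridPatch_sites`) and `ℓ⁻²·ℓ² = 1`. [cite: Balaban1985BackgroundPropagators, (3.10) p.392, (3.100) p.413] -/
theorem feedCu (hnK : n ≤ K) (W : GaugeField (F.P K) 0 (Matrix.specialUnitaryGroup (Fin 2) ℂ)) (c : Site (F.P K) 0) (g : Fin 3 → ℕ)
    (hcg : iterBlockOf (K - n) c = fun κ => ((g κ * F.L ^ s : ℕ) : ZMod ((F.P K).sitesPerDir (K - n))))
    (z : Zd (F.P K).d) (R : ℤ)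
    (hz : z = (fun κ : Fin (F.P K).d => ((F.L ^ (K - n) : ℕ) : ℤ) *
          (((((c κ).val : ℕ) : ℤ) - ((((basePt F n K) κ).val : ℕ) : ℤ)) / ((F.L ^ (K - n) : ℕ) : ℤ)) + (((F.L ^ (K - n) : ℕ) : ℤ) - 1) / 2))
    (hRdef : R = ((2 * ((F.L ^ s : ℕ) : ℤ) + 1) * ((F.L ^ (K - n) : ℕ) : ℤ) + (((F.L ^ (K - n) : ℕ) : ℤ) - 1) / 2)) (hRN : 2 * R + 1 ≤ ((F.P K).sitesPerDir 0 : ℤ))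
    (V : Zd (F.P K).d → Fin (F.P K).d → (Matrix (Fin 2) (Fin 2) ℂ)ˣ) (hV : ∀ w μ, V w μ = unitsField (toUField W) ⟨transl (basePt F n K) w, μ⟩)
    (y : BondL2K ℂ 3 (periodsT3 F K) c₀ W₂) :
    c₀ * ∑ w ∈ box z R, ∑ μ, ∑ ν, (if w + unitVec μ + unitVec ν ∈ box z R then
        ∑ j : Fin 2, ∑ k : Fin 2, ‖((toL2 F K c₀).symm y ⟨transl (basePt F n K) w, μ⟩
          + conjR (V w μ) ((toL2 F K c₀).symm y ⟨transl (basePt F n K) (w + unitVec μ), ν⟩)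
          - conjR (V w ν) ((toL2 F K c₀).symm y ⟨transl (basePt F n K) (w + unitVec ν), μ⟩)
          - (toL2 F K c₀).symm y ⟨transl (basePt F n K) w, ν⟩) j k‖ ^ 2 else 0)
      ≤ 2 * ((F.L : ℝ) ^ (K - n))⁻¹ ^ 2 *
        ∑ x ∈ Finset.univ.filter (fun x : Site (F.P K) 0 => ∀ κ : Fin 3,
          min ((iterBlockOf (K - n) x) κ - ((g κ * F.L ^ s : ℕ) : ZMod ((F.P K).sitesPerDir (K - n)))).val
            ((((g κ * F.L ^ s : ℕ) : ZMod ((F.P K).sitesPerDir (K - n)))) - (iterBlockOf (K - n) x) κ).val ≤ 2 * F.L ^ s + 2),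
          c₀ * ((F.L : ℝ) ^ (K - n)) ^ 2 * (∑ μ : Fin (F.P K).d, ∑ ν : Fin (F.P K).d, (if μ < ν then ∑ j : Fin 2, ∑ k : Fin 2,
            ‖(curl (torusT (F.P K) 0) (fun κ z => unitsField (toUField W) ⟨z, κ⟩) (fun κ z => (toL2 F K c₀).symm y ⟨z, κ⟩) μ ν x) j k‖ ^ 2 else 0)) := by
  subst hz hRdef
  have hL : (0 : ℝ) < (F.L : ℝ) := by have := F.hL.2; exact_mod_cast (by omega : 0 < F.L)
  have hℓ : ((F.L : ℝ) ^ (K - n)) ≠ 0 := pow_ne_zero _ hL.ne'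
  have h := box_curlF_le_two_mul_curlHS_on F K c₀ W (basePt F n K) hRN V hV y (Finset.univ.filter (fun x : Site (F.P K) 0 => ∀ κ : Fin 3,
          min ((iterBlockOf (K - n) x) κ - ((g κ * F.L ^ s : ℕ) : ZMod ((F.P K).sitesPerDir (K - n)))).val
            ((((g κ * F.L ^ s : ℕ) : ZMod ((F.P K).sitesPerDir (K - n)))) - (iterBlockOf (K - n) x) κ).val ≤ 2 * F.L ^ s + 2))
    (fun w hw => transl_mem_gridPatch_sites F n K s hnK (basePt F n K) c g hcg w hw)
  refine h.trans (le_of_eq ?_)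
  rw [← Finset.mul_sum]
  field_simp

/-- ★★ **THE LOCAL CURL LETTER ≤ THE CURL CURRENCY**: `c₀·ℓ²·Σ_(w ∈ box z R) Σ_(μ<ν)‖curl_W y (transl basePt w)‖_F² ≤ Σ_(x ∈ site patch) c₀·ℓ²·Σ_(μ<ν)‖curl_W y x‖_F²` — the `CuW`
atom of `patch_rows_core`'s h9∕h10 rows against the SAME `Cu` (injective chart `Finset.sum_image` + patch membership + nonnegativity). [cite: Balaban1985BackgroundPropagators, (3.100) p.413] -/
theorem feedCuW (hnK : n ≤ K) (W : GaugeField (F.P K) 0 (Matrix.specialUnitaryGroup (Fin 2) ℂ)) (c : Site (F.P K) 0) (g : Fin 3 → ℕ)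
    (hcg : iterBlockOf (K - n) c = fun κ => ((g κ * F.L ^ s : ℕ) : ZMod ((F.P K).sitesPerDir (K - n))))
    (z : Zd (F.P K).d) (R : ℤ)
    (hz : z = (fun κ : Fin (F.P K).d => ((F.L ^ (K - n) : ℕ) : ℤ) *
          (((((c κ).val : ℕ) : ℤ) - ((((basePt F n K) κ).val : ℕ) : ℤ)) / ((F.L ^ (K - n) : ℕ) : ℤ)) + (((F.L ^ (K - n) : ℕ) : ℤ) - 1) / 2))
    (hRdef : R = ((2 * ((F.L ^ s : ℕ) : ℤ) + 1) * ((F.L ^ (K - n) : ℕ) : ℤ) + (((F.L ^ (K - n) : ℕ) : ℤ) - 1) / 2)) (hRN : 2 * R + 1 ≤ ((F.P K).sitesPerDir 0 : ℤ))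
    (y : BondL2K ℂ 3 (periodsT3 F K) c₀ W₂) :
    c₀ * ((F.L : ℝ) ^ (K - n)) ^ 2 * (∑ w ∈ box z R, ∑ μ : Fin (F.P K).d, ∑ ν : Fin (F.P K).d,
        (if μ < ν then ∑ j : Fin 2, ∑ k : Fin 2,
          ‖(curl (torusT (F.P K) 0) (fun κ x => unitsField (toUField W) ⟨x, κ⟩) (fun κ x => (toL2 F K c₀).symm y ⟨x, κ⟩) μ ν (transl (basePt F n K) w)) j k‖ ^ 2
        else 0))
      ≤ ∑ x ∈ Finset.univ.filter (fun x : Site (F.P K) 0 => ∀ κ : Fin 3,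
          min ((iterBlockOf (K - n) x) κ - ((g κ * F.L ^ s : ℕ) : ZMod ((F.P K).sitesPerDir (K - n)))).val
            ((((g κ * F.L ^ s : ℕ) : ZMod ((F.P K).sitesPerDir (K - n)))) - (iterBlockOf (K - n) x) κ).val ≤ 2 * F.L ^ s + 2),
          c₀ * ((F.L : ℝ) ^ (K - n)) ^ 2 * (∑ μ : Fin (F.P K).d, ∑ ν : Fin (F.P K).d, (if μ < ν then ∑ j : Fin 2, ∑ k : Fin 2,
            ‖(curl (torusT (F.P K) 0) (fun κ z => unitsField (toUField W) ⟨z, κ⟩) (fun κ z => (toL2 F K c₀).symm y ⟨z, κ⟩) μ ν x) j k‖ ^ 2 else 0)) := by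
  classical
  subst hz hRdef
  have hc : 0 < c₀ := hc₀.out
  rw [← Finset.mul_sum]
  refine mul_le_mul_of_nonneg_left ?_ (by positivity)
  have hinj := transl_injOn_box (basePt F n K) hRN (z := (fun κ : Fin (F.P K).d => ((F.L ^ (K - n) : ℕ) : ℤ) *
          (((((c κ).val : ℕ) : ℤ) - ((((basePt F n K) κ).val : ℕ) : ℤ)) / ((F.L ^ (K - n) : ℕ) : ℤ)) + (((F.L ^ (K - n) : ℕ) : ℤ) - 1) / 2))
    (R := ((2 * ((F.L ^ s : ℕ) : ℤ) + 1) * ((F.L ^ (K - n) : ℕ) : ℤ) + (((F.L ^ (K - n) : ℕ) : ℤ) - 1) / 2))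
  rw [← Finset.sum_image (f := fun x => (∑ μ : Fin (F.P K).d, ∑ ν : Fin (F.P K).d, (if μ < ν then ∑ j : Fin 2, ∑ k : Fin 2,
            ‖(curl (torusT (F.P K) 0) (fun κ z => unitsField (toUField W) ⟨z, κ⟩) (fun κ z => (toL2 F K c₀).symm y ⟨z, κ⟩) μ ν x) j k‖ ^ 2 else 0))) hinj]
  refine Finset.sum_le_sum_of_subset_of_nonneg ?_ ?_
  · intro x hx
    obtain ⟨w, hw, rfl⟩ := Finset.mem_image.mp hx
    exact transl_mem_gridPatch_sites F n K s hnK (basePt F n K) c g hcg w hw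
  · intro x _ _
    refine Finset.sum_nonneg fun μ _ => Finset.sum_nonneg fun ν _ => ?_
    split_ifs
    · exact Finset.sum_nonneg fun j _ => Finset.sum_nonneg fun k _ => sq_nonneg _
    · exact le_rfl

/-! ## §3 The coarse feed -/

omit hc₀ in
/-- ★ **THE COARSE FEED**: a coarse-bond set `S` whose sources carry the peel margin `dist(ĉ.src κ, C κ) + 3 ≤ 2·L^s` (w1's `hSC`; `C κ = ↑(g_κ·L^s)` the grid site) lies inside px9's
coarse patch at `D = 2·L^s + 2`, so every nonnegative weight sums to more over the patch. [cite: Balaban1985BackgroundPropagators, (3.100) p.413] -/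
theorem feedAs (C : Site (F.P K) (K - n)) (g : Fin 3 → ℕ) (hC : ∀ κ : Fin 3, C κ = ((g κ * F.L ^ s : ℕ) : ZMod ((F.P K).sitesPerDir (K - n))))
    (S : Finset (PBond (F.P K) (K - n))) (hSC : ∀ chat ∈ S, ∀ κ : Fin 3, min (chat.src κ - C κ).val (C κ - chat.src κ).val + 3 ≤ 2 * F.L ^ s)
    (w : PBond (F.P K) (K - n) → ℝ) (hw : ∀ c, 0 ≤ w c) :
    ∑ c ∈ S, w c ≤ ∑ c ∈ Finset.univ.filter (fun c : PBond (F.P K) (K - n) => ∀ κ : Fin 3,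
          min ((c.src) κ - ((g κ * F.L ^ s : ℕ) : ZMod ((F.P K).sitesPerDir (K - n)))).val
            ((((g κ * F.L ^ s : ℕ) : ZMod ((F.P K).sitesPerDir (K - n)))) - (c.src) κ).val ≤ 2 * F.L ^ s + 2), w c := by
  classical
  refine Finset.sum_le_sum_of_subset_of_nonneg (fun chat hchat => ?_) fun c _ _ => hw c
  refine Finset.mem_filter.mpr ⟨Finset.mem_univ _, fun κ => ?_⟩
  have h := hSC chat hchat κ
  rw [hC κ] at h
  omega

/-! ## §4 The transition-cube mass feed (PEEL `p = 5`) -/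

/-- ★★ **`patch_rows_core`'s `hboxS` DISCHARGED** (universal in the field): the `c₀`-mass of any site field over the cube `Scube(c) = (cyclic sup-distance to c < L^s·ℓ + 2)` is at most its
`c₀`-mass over the chart points of the PEELED box `box z_c Rin`, `Rin + 5ℓ = R_f` — px9's §4 `exists_mem_peeledBox_of_dist_lt` (every cube point is such a chart point; needs `5 ≤ L^s`) and
✓`sum_le_boxSum_of_chart` (injective chart, nonnegative summand).  Right side = the mass letter of ✓`h7h8_member_peeled` ∕ ✓`currency_h7h8_peeled` at `Rin`.
[cite: Balaban1985BackgroundPropagators, (3.100) p.413] -/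
theorem feedBoxS (h5 : 5 ≤ F.L ^ s) (c : Site (F.P K) 0) (z : Zd (F.P K).d) (R : ℤ)
    (hz : z = (fun κ : Fin (F.P K).d => ((F.L ^ (K - n) : ℕ) : ℤ) *
          (((((c κ).val : ℕ) : ℤ) - ((((basePt F n K) κ).val : ℕ) : ℤ)) / ((F.L ^ (K - n) : ℕ) : ℤ)) + (((F.L ^ (K - n) : ℕ) : ℤ) - 1) / 2))
    (hRdef : R = ((2 * ((F.L ^ s : ℕ) : ℤ) + 1) * ((F.L ^ (K - n) : ℕ) : ℤ) + (((F.L ^ (K - n) : ℕ) : ℤ) - 1) / 2)) (hRN : 2 * R + 1 ≤ ((F.P K).sitesPerDir 0 : ℤ))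
    {Rin : ℤ} (hRin : Rin + ((5 : ℕ) : ℤ) * ((F.L ^ (K - n) : ℕ) : ℤ) = R)
    (φ' : SiteL2K ℂ 3 (periodsT3 F K) c₀ W₂) :
    c₀ * ∑ x ∈ (Finset.univ.filter fun y : Site (F.P K) 0 => ∀ κ : Fin 3, min (y κ - c κ).val (c κ - y κ).val < F.L ^ s * F.L ^ (K - n) + 2),
        ∑ j : Fin 2, ∑ k : Fin 2, ‖((toL2S F K c₀).symm φ' x) j k‖ ^ 2
      ≤ c₀ * ∑ w ∈ box z Rin, ∑ j : Fin 2, ∑ k : Fin 2, ‖((toL2S F K c₀).symm φ' (transl (basePt F n K) w)) j k‖ ^ 2 := by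
  classical
  subst hz hRdef
  have hc : 0 < c₀ := hc₀.out
  have hL : 0 < F.L := by have := F.hL.2; omega
  have hℓ0 : (0 : ℤ) ≤ ((F.L ^ (K - n) : ℕ) : ℤ) := by positivity
  have hRinle : Rin ≤ ((2 * ((F.L ^ s : ℕ) : ℤ) + 1) * ((F.L ^ (K - n) : ℕ) : ℤ) + (((F.L ^ (K - n) : ℕ) : ℤ) - 1) / 2) := by
    have : (0 : ℤ) ≤ ((5 : ℕ) : ℤ) * ((F.L ^ (K - n) : ℕ) : ℤ) := by positivity
    omega
  have hRinN : 2 * Rin + 1 ≤ ((F.P K).sitesPerDir 0 : ℤ) := by omega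
  refine mul_le_mul_of_nonneg_left ?_ hc.le
  refine sum_le_boxSum_of_chart (F := F) (K := K) (basePt F n K) hRinN
    (fun x => ∑ j : Fin 2, ∑ k : Fin 2, ‖((toL2S F K c₀).symm φ' x) j k‖ ^ 2)
    (fun x => Finset.sum_nonneg fun j _ => Finset.sum_nonneg fun k _ => sq_nonneg _) _ ?_
  intro x hx
  exact exists_mem_peeledBox_of_dist_lt F n K s 5 h5 (basePt F n K) c x hRin (Finset.mem_filter.mp hx).2

end Summit.QuantumFields.YangMills.Theorems.Prop7DivRecoveryPatchFeeds

end
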